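import Literature.Geometry.Kaehler.ComplexTorusHodgeLieAlgebraProductsPowers
import Literature.Geometry.Kaehler.ComplexTorusHodgeLieAlgebraCommutativeDimension
import HarnessLib

/-!
# The Cartan parts of a power: `𝔨(Xᴺ) = Δ_N 𝔨(X)`, `𝔭(Xᴺ) = Δ_N 𝔭(X)`, `dim 𝔨(Xᴺ) = dim 𝔨(X)`, `dim 𝔭(Xᴺ) = dim 𝔭(X)`;
# powers of an elliptic curve: `(dim 𝔨, dim 𝔭, dim 𝔥𝔤_ℝ)(E_τᴺ) = (1, 0, 1)` (CM) or `(1, 2, 3)` (no CM)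

[cite: MoonenZarhin1999LowDim, §1 and §2 (2.1)] [cite: GreenGriffithsKerr2012, §I.B (I.B.3) and §IV.E] [cite: Imai1976HodgeGroups, §2 (p. 368)]
[cite: FiteEtAl2012, §4.2 (types **E**, **F**)]

Layer `Literature/Geometry/Kaehler`, namespace `Literature.Geometry.Kaehler.ComplexTorus`; lane `lit-hodgefound`
(Track 2 foundations library), Layer A, prover seat p17 (generation 20), self-proposed row g20-#4 of
`run/shared/lean/pub/lit-hodgefound/SKELETON.md` — the Cartan-decomposition refinement of row g17-#4
(`ComplexTorusHodgeLieAlgebraProductsPowers` / `ComplexTorusHodgeLieAlgebraHodgeClassesOfPowers`: `𝔥𝔤_ℝ(Xᴺ) = Δ_N 𝔥𝔤_ℝ(X)`,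
`coe_hodgeGroupLie_pow`, `diagPow_mem_hodgeGroupLie_pow_iff`, `eq_diagPow_of_mem_hodgeGroupLie_pow`, `finrank_hodgeGroupLie_pow`),
and the power companion of rows g20-#2 / g20-#3 (`ComplexTorusHodgeLieAlgebraEllipticProducts`, `…IsogenousProducts`: the five
product types of abelian surfaces).  Consumed BY NAME besides g17-#4: `jMatrix_powPeriod` (`ComplexTorusEndomorphismAlgebraProduct`),
`diagPow`, `diagPow_apply`, `diagPow_injective` (`ComplexTorusLefschetzGroupProduct`: `Δ_N` is an injective `ℝ`-algebra homomorphism),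
p40's `mem_hodgeIsotropyLie_iff` / `mem_hodgeCartanP_iff`, the g18-#2 rider (`dim 𝔥𝔤_ℝ = dim 𝔨 + dim 𝔭`, `dim 𝔨 ≥ 1`,
`𝔭(E_τ) ≠ 0` without CM, `𝔭 ≠ 0 ⟹ dim 𝔭 ≥ 2`) and g17-#2 (`dim 𝔥𝔤_ℝ(E_τ) = 1` or `3`).  THEOREMS ONLY: no definition, no named
fact, no instance attribute (`LieRing.ofAssociativeRing` bound by `letI` inside one proof), net debt 0; imports only built modules.

## The mathematics and its sources, quoted

"For `n ≥ 1` we can identify `Hg(Xⁿ)` with `Hg(X)`, acting diagonally on `V_{Xⁿ} = (V_X)ⁿ`" [MoonenZarhin1999LowDim, §1];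
infinitesimally `𝔥𝔤_ℝ(Xᴺ) = Δ_N 𝔥𝔤_ℝ(X)` with `Δ_N A = 1_N ⊗ A` (g17-#4).  The complex structure of the power is
`J_{Xᴺ} = Δ_N J_X`, and `Δ_N` is an injective algebra homomorphism, so `Δ_N A` commutes (anticommutes) with `J_{Xᴺ}` iff `A`
commutes (anticommutes) with `J_X`: the Cartan decomposition `𝔤_ℝ = 𝔨 ⊕ 𝔭` [GreenGriffithsKerr2012, §IV.E] of the power is
`𝔨(Xᴺ) = Δ_N 𝔨(X)`, `𝔭(Xᴺ) = Δ_N 𝔭(X)`, with `dim 𝔨(Xᴺ) = dim 𝔨(X)`, `dim 𝔭(Xᴺ) = dim 𝔭(X)`; in particular `Xᴺ` is of CM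
type (`𝔭 = 0`, `Hg` compact [Mumford1969NoteShimura, §2]) iff `X` is.  For an elliptic curve ("`Hg(E)` is a 1-dimensional
torus if `E` is of CM-type, … `Hg(E) = SL₂` if `E` is not of CM-type" [Imai1976HodgeGroups, §2 (p. 368)]) every power has
`(dim 𝔨, dim 𝔭, dim 𝔥𝔤_ℝ)(E_τᴺ) = (1, 0, 1)` resp. `(1, 2, 3)` — for `N = 2` the abelian-surface types `𝔲(1)`, `𝔰𝔩₂(ℝ)`
(connected Sato–Tate groups `U(1)`, `SU(2)`: [FiteEtAl2012, §4.2] types **F**, **E**), and for every `N ≥ 2` a power of an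
elliptic curve has the one-dimensional isotropy `ℝJ`, never `𝔲(N)`.

## What is proved

§1 (any torus, `N ≥ 1`) **`diagPow_mem_hodgeIsotropyLie_pow_iff`**, **`diagPow_mem_hodgeCartanP_pow_iff`**,
**`mem_hodgeIsotropyLie_pow_iff_exists`** (`𝔨(Xᴺ) = Δ_N 𝔨(X)`), **`mem_hodgeCartanP_pow_iff_exists`**,
`hodgeCartanP_pow_eq_map` (`𝔭(Xᴺ) = Δ_N 𝔭(X)`),
**`finrank_hodgeIsotropyLie_pow`**, **`finrank_hodgeCartanP_pow`**, `hodgeCartanP_pow_eq_bot_iff`.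
§2 `finrank_triple_pow_ellipticPeriod_of_ne_bot` (`(1,0,1)`), `finrank_triple_pow_ellipticPeriod_of_eq_bot` (`(1,2,3)`),
`finrank_hodgeIsotropyLie_pow_ellipticPeriod` (`dim 𝔨(E_τᴺ) = 1`).

NOT here: products of distinct factors (g20-#2, g20-#3); the adjoint / bracket structure of `Δ_N`; the `ℚ`-structure.

## References

* [MoonenZarhin1999LowDim] B. Moonen, Yu. G. Zarhin, *Hodge classes on abelian varieties of low dimension*, Math. Ann. 315
  (1999) 711–733, §1, §2 (2.1) (held copy `paper:arxiv-math_9901113`, p0003, p0005).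
* [GreenGriffithsKerr2012] M. Green, P. Griffiths, M. Kerr, *Mumford–Tate Groups and Domains* (2012), §I.B (I.B.3), §IV.E.
* [Imai1976HodgeGroups] H. Imai, *On the Hodge groups of some abelian varieties*, Kodai Math. Sem. Rep. 27 (1976), §2 (p. 368).
* [FiteEtAl2012] F. Fité, K. S. Kedlaya, V. Rotger, A. V. Sutherland, *Sato–Tate distributions and Galois endomorphism modules
  in genus 2*, Compositio Math. 148 (2012), §4.2 (held copy `paper:arxiv-1110.6638`, p0014).
* [Mumford1969NoteShimura] D. Mumford, *A note of Shimura's paper "Discontinuous groups and abelian varieties"*, Math. Ann.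
  181 (1969) 345–351, §2.
-/

noncomputable section

open scoped Matrix Real

open Set Function Module Matrix NormedSpace Complex

namespace Literature.Geometry.Kaehler

namespace ComplexTorus

section Power

variable {ι : Type*} [Fintype ι] [DecidableEq ι] {E : Type*} [NormedAddCommGroup E] [NormedSpace ℂ E]
  (Φ : (ι → ℝ) ≃L[ℝ] E)

/-- `J_{Xᴺ} = Δ_N J_X` (a local copy of `jMatrix_powPeriod_eq_diagPow` of `ComplexTorusLefschetzGroupPower`, whose build is
not available to this file). [cite: MoonenZarhin1999LowDim, §1] -/
private theorem jMatrix_pow_eq_diagPow (N : ℕ) : jMatrix (powPeriod Φ N) = diagPow ι N (jMatrix Φ) := by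
  rw [jMatrix_powPeriod, diagPow_apply]

/-- **`Δ_N X ∈ 𝔨(Xᴺ) ⟺ X ∈ 𝔨(X)`** (`N ≥ 1`): `𝔥𝔤_ℝ(Xᴺ) = Δ_N 𝔥𝔤_ℝ(X)` (g17-#4 / Moonen–Zarhin §1), `J_{Xᴺ} = Δ_N J_X` and `Δ_N` is an
injective algebra homomorphism. [cite: MoonenZarhin1999LowDim, §1 ("we can identify `Hg(Xⁿ)` with `Hg(X)`, acting diagonally")]
[cite: GreenGriffithsKerr2012, §IV.E (Cartan decomposition `𝔤_ℝ = 𝔨 ⊕ 𝔭`)] -/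
theorem diagPow_mem_hodgeIsotropyLie_pow_iff {N : ℕ} (hN : 0 < N) {X : Matrix ι ι ℝ} :
    diagPow ι N X ∈ hodgeIsotropyLie (powPeriod Φ N) ↔ X ∈ hodgeIsotropyLie Φ := by
  rw [mem_hodgeIsotropyLie_iff, mem_hodgeIsotropyLie_iff, diagPow_mem_hodgeGroupLie_pow_iff (Φ := Φ) hN,
    jMatrix_pow_eq_diagPow, ← map_mul, ← map_mul, (diagPow_injective N hN).eq_iff]

/-- **`Δ_N X ∈ 𝔭(Xᴺ) ⟺ X ∈ 𝔭(X)`** (`N ≥ 1`). [cite: MoonenZarhin1999LowDim, §1] [cite: GreenGriffithsKerr2012, §IV.E] -/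
theorem diagPow_mem_hodgeCartanP_pow_iff {N : ℕ} (hN : 0 < N) {X : Matrix ι ι ℝ} :
    diagPow ι N X ∈ hodgeCartanP (powPeriod Φ N) ↔ X ∈ hodgeCartanP Φ := by
  rw [mem_hodgeCartanP_iff, mem_hodgeCartanP_iff, diagPow_mem_hodgeGroupLie_pow_iff (Φ := Φ) hN,
    jMatrix_pow_eq_diagPow, ← map_mul, ← map_mul, ← map_neg, (diagPow_injective N hN).eq_iff]

/-- `𝔨(Xᴺ) = Δ_N 𝔨(X)` as sets of matrices (`N ≥ 1`; kept private — the public forms are the membership and submodule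
versions below). [cite: MoonenZarhin1999LowDim, §1] [cite: GreenGriffithsKerr2012, §IV.E] -/
private theorem coe_hodgeIsotropyLie_pow {N : ℕ} (hN : 0 < N) :
    (hodgeIsotropyLie (powPeriod Φ N) : Set (Matrix (Fin N × ι) (Fin N × ι) ℝ)) =
      diagPow ι N '' (hodgeIsotropyLie Φ : Set (Matrix ι ι ℝ)) := by
  refine Set.Subset.antisymm (fun Y hY ↦ ?_) ?_
  · have hY' : Y ∈ hodgeIsotropyLie (powPeriod Φ N) := hY
    have hYeq := eq_diagPow_of_mem_hodgeGroupLie_pow ⟨0, hN⟩ ((mem_hodgeIsotropyLie_iff _).1 hY').1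
    refine ⟨fun i j ↦ Y ((⟨0, hN⟩ : Fin N), i) ((⟨0, hN⟩ : Fin N), j), ?_, hYeq.symm⟩
    rw [SetLike.mem_coe, ← diagPow_mem_hodgeIsotropyLie_pow_iff Φ hN, ← hYeq]
    exact hY'
  · rintro _ ⟨X, hX, rfl⟩
    exact (diagPow_mem_hodgeIsotropyLie_pow_iff Φ hN).2 hX

/-- `𝔭(Xᴺ) = Δ_N 𝔭(X)` as sets of matrices (`N ≥ 1`; private). [cite: MoonenZarhin1999LowDim, §1] [cite: GreenGriffithsKerr2012, §IV.E] -/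
private theorem coe_hodgeCartanP_pow {N : ℕ} (hN : 0 < N) :
    (hodgeCartanP (powPeriod Φ N) : Set (Matrix (Fin N × ι) (Fin N × ι) ℝ)) =
      diagPow ι N '' (hodgeCartanP Φ : Set (Matrix ι ι ℝ)) := by
  refine Set.Subset.antisymm (fun Y hY ↦ ?_) ?_
  · have hY' : Y ∈ hodgeCartanP (powPeriod Φ N) := hY
    have hYeq := eq_diagPow_of_mem_hodgeGroupLie_pow ⟨0, hN⟩ ((mem_hodgeCartanP_iff _).1 hY').1
    refine ⟨fun i j ↦ Y ((⟨0, hN⟩ : Fin N), i) ((⟨0, hN⟩ : Fin N), j), ?_, hYeq.symm⟩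
    rw [SetLike.mem_coe, ← diagPow_mem_hodgeCartanP_pow_iff Φ hN, ← hYeq]
    exact hY'
  · rintro _ ⟨X, hX, rfl⟩
    exact (diagPow_mem_hodgeCartanP_pow_iff Φ hN).2 hX

/-- **`𝔨(Xᴺ) = Δ_N 𝔨(X)`: `Y ∈ 𝔨(Xᴺ) ⟺ Y = Δ_N X` for some `X ∈ 𝔨(X)`** (`N ≥ 1`).
[cite: MoonenZarhin1999LowDim, §1] [cite: GreenGriffithsKerr2012, §IV.E] -/
theorem mem_hodgeIsotropyLie_pow_iff_exists {N : ℕ} (hN : 0 < N) {Y : Matrix (Fin N × ι) (Fin N × ι) ℝ} :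
    Y ∈ hodgeIsotropyLie (powPeriod Φ N) ↔ ∃ X ∈ hodgeIsotropyLie Φ, Y = diagPow ι N X := by
  have h := Set.ext_iff.1 (coe_hodgeIsotropyLie_pow Φ hN) Y
  simp only [SetLike.mem_coe, Set.mem_image] at h
  rw [h]
  exact ⟨fun ⟨X, hX, hXY⟩ ↦ ⟨X, hX, hXY.symm⟩, fun ⟨X, hX, hXY⟩ ↦ ⟨X, hX, hXY.symm⟩⟩

/-- **`𝔭(Xᴺ) = Δ_N 𝔭(X)`: `Y ∈ 𝔭(Xᴺ) ⟺ Y = Δ_N X` for some `X ∈ 𝔭(X)`** (`N ≥ 1`).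
[cite: MoonenZarhin1999LowDim, §1] [cite: GreenGriffithsKerr2012, §IV.E] -/
theorem mem_hodgeCartanP_pow_iff_exists {N : ℕ} (hN : 0 < N) {Y : Matrix (Fin N × ι) (Fin N × ι) ℝ} :
    Y ∈ hodgeCartanP (powPeriod Φ N) ↔ ∃ X ∈ hodgeCartanP Φ, Y = diagPow ι N X := by
  have h := Set.ext_iff.1 (coe_hodgeCartanP_pow Φ hN) Y
  simp only [SetLike.mem_coe, Set.mem_image] at h
  rw [h]
  exact ⟨fun ⟨X, hX, hXY⟩ ↦ ⟨X, hX, hXY.symm⟩, fun ⟨X, hX, hXY⟩ ↦ ⟨X, hX, hXY.symm⟩⟩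

/-- **`𝔭(Xᴺ) = Δ_N 𝔭(X)` as real subspaces**: `𝔭(Xᴺ)` is the image of `𝔭(X)` under the linear map `Δ_N`.
[cite: MoonenZarhin1999LowDim, §1] [cite: GreenGriffithsKerr2012, §IV.E] -/
theorem hodgeCartanP_pow_eq_map {N : ℕ} (hN : 0 < N) :
    hodgeCartanP (powPeriod Φ N) = (hodgeCartanP Φ).map (diagPow ι N).toLinearMap := by
  refine SetLike.coe_injective ?_
  rw [Submodule.map_coe, coe_hodgeCartanP_pow Φ hN]
  rfl

/-- **`dim_ℝ 𝔨(Xᴺ) = dim_ℝ 𝔨(X)`** (`N ≥ 1`). [cite: MoonenZarhin1999LowDim, §1] [cite: GreenGriffithsKerr2012, §IV.E] -/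
theorem finrank_hodgeIsotropyLie_pow {N : ℕ} (hN : 0 < N) :
    finrank ℝ (hodgeIsotropyLie (powPeriod Φ N)) = finrank ℝ (hodgeIsotropyLie Φ) := by
  letI : LieRing (Matrix ι ι ℝ) := LieRing.ofAssociativeRing
  letI : LieRing (Matrix (Fin N × ι) (Fin N × ι) ℝ) := LieRing.ofAssociativeRing
  have hmap : (hodgeIsotropyLie (powPeriod Φ N)).toSubmodule =
      (hodgeIsotropyLie Φ).toSubmodule.map (diagPow ι N).toLinearMap := by
    refine SetLike.coe_injective ?_
    rw [Submodule.map_coe, LieSubalgebra.coe_toSubmodule, LieSubalgebra.coe_toSubmodule, coe_hodgeIsotropyLie_pow Φ hN]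
    rfl
  change finrank ℝ (hodgeIsotropyLie (powPeriod Φ N)).toSubmodule = finrank ℝ (hodgeIsotropyLie Φ).toSubmodule
  rw [hmap]
  exact (Submodule.equivMapOfInjective _ (diagPow_injective N hN) _).finrank_eq.symm

/-- **`dim_ℝ 𝔭(Xᴺ) = dim_ℝ 𝔭(X)`** (`N ≥ 1`). [cite: MoonenZarhin1999LowDim, §1] [cite: GreenGriffithsKerr2012, §IV.E] -/
theorem finrank_hodgeCartanP_pow {N : ℕ} (hN : 0 < N) :
    finrank ℝ (hodgeCartanP (powPeriod Φ N)) = finrank ℝ (hodgeCartanP Φ) := by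
  rw [hodgeCartanP_pow_eq_map Φ hN]
  exact (Submodule.equivMapOfInjective _ (diagPow_injective N hN) _).finrank_eq.symm

/-- **`𝔭(Xᴺ) = 0 ⟺ 𝔭(X) = 0`** (`N ≥ 1`): a power is of CM type (`Hg` compact, g18-#2) iff the base is.
[cite: MoonenZarhin1999LowDim, §1] [cite: Mumford1969NoteShimura, §2] -/
theorem hodgeCartanP_pow_eq_bot_iff {N : ℕ} (hN : 0 < N) : hodgeCartanP (powPeriod Φ N) = ⊥ ↔ hodgeCartanP Φ = ⊥ := by
  rw [← Submodule.finrank_eq_zero, ← Submodule.finrank_eq_zero, finrank_hodgeCartanP_pow Φ hN]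

end Power

/-! ## §2 Powers of an elliptic curve: `(dim 𝔨, dim 𝔭, dim 𝔥𝔤_ℝ)(E_τᴺ) = (1, 0, 1)` or `(1, 2, 3)` -/

section EllipticPower

variable {τ : ℂ} (hτ : τ.im ≠ 0)

include hτ in
/-- **`(dim 𝔨, dim 𝔭, dim 𝔥𝔤_ℝ)(E_τᴺ) = (1, 0, 1)` for a CM curve** (`N ≥ 1`; `Hg(Eᴺ) = Δ_N U_F`, type `𝔲(1)`).
[cite: MoonenZarhin1999LowDim, §1 and §2 (2.1)] [cite: Imai1976HodgeGroups, §2 (p. 368)] [cite: FiteEtAl2012, §4.2 (type **F**)] -/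
theorem finrank_triple_pow_ellipticPeriod_of_ne_bot (h : ellipticEnd hτ ≠ ⊥) {N : ℕ} (hN : 0 < N) :
    finrank ℝ (hodgeIsotropyLie (powPeriod (ellipticPeriod hτ) N)) = 1 ∧
      finrank ℝ (hodgeCartanP (powPeriod (ellipticPeriod hτ) N)) = 0 ∧
        finrank ℝ (hodgeGroupLie (powPeriod (ellipticPeriod hτ) N)) = 1 := by
  rw [finrank_hodgeIsotropyLie_pow _ hN, finrank_hodgeCartanP_pow _ hN, finrank_hodgeGroupLie_pow _ hN]
  have h1 := finrank_hodgeGroupLie_ellipticPeriod_of_ne_bot hτ h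
  have h2 := finrank_hodgeGroupLie_eq_finrank_hodgeIsotropyLie_add_finrank_hodgeCartanP (ellipticPeriod hτ)
  have h3 := finrank_hodgeIsotropyLie_pos (ellipticPeriod hτ)
  omega

include hτ in
/-- **`(dim 𝔨, dim 𝔭, dim 𝔥𝔤_ℝ)(E_τᴺ) = (1, 2, 3)` for a curve without complex multiplication** (`N ≥ 1`; `Hg(Eᴺ) = Δ_N SL₂`,
type `𝔰𝔩₂(ℝ)`). [cite: MoonenZarhin1999LowDim, §1 and §2 (2.1)] [cite: Imai1976HodgeGroups, §2 (p. 368)] [cite: FiteEtAl2012, §4.2 (type **E**)] -/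
theorem finrank_triple_pow_ellipticPeriod_of_eq_bot (h : ellipticEnd hτ = ⊥) {N : ℕ} (hN : 0 < N) :
    finrank ℝ (hodgeIsotropyLie (powPeriod (ellipticPeriod hτ) N)) = 1 ∧
      finrank ℝ (hodgeCartanP (powPeriod (ellipticPeriod hτ) N)) = 2 ∧
        finrank ℝ (hodgeGroupLie (powPeriod (ellipticPeriod hτ) N)) = 3 := by
  rw [finrank_hodgeIsotropyLie_pow _ hN, finrank_hodgeCartanP_pow _ hN, finrank_hodgeGroupLie_pow _ hN]
  have h1 := finrank_hodgeGroupLie_ellipticPeriod_of_eq_bot hτ h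
  have h2 := finrank_hodgeGroupLie_eq_finrank_hodgeIsotropyLie_add_finrank_hodgeCartanP (ellipticPeriod hτ)
  have h3 := finrank_hodgeIsotropyLie_pos (ellipticPeriod hτ)
  have h4 := two_le_finrank_hodgeCartanP_of_ne_bot (ellipticPeriod hτ) (hodgeCartanP_ellipticPeriod_ne_bot_of_eq_bot hτ h)
  omega

include hτ in
/-- **`dim 𝔨(E_τᴺ) = 1` for every elliptic curve and `N ≥ 1`**: a power of an elliptic curve has one-dimensional isotropy `ℝJ`
(never `𝔲(g)` for `g = N ≥ 2`). [cite: MoonenZarhin1999LowDim, §1] [cite: Imai1976HodgeGroups, §2 (p. 368)] -/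
theorem finrank_hodgeIsotropyLie_pow_ellipticPeriod {N : ℕ} (hN : 0 < N) :
    finrank ℝ (hodgeIsotropyLie (powPeriod (ellipticPeriod hτ) N)) = 1 := by
  by_cases h : ellipticEnd hτ = ⊥
  · exact (finrank_triple_pow_ellipticPeriod_of_eq_bot hτ h hN).1
  · exact (finrank_triple_pow_ellipticPeriod_of_ne_bot hτ h hN).1

end EllipticPower

end ComplexTorus

end Literature.Geometry.Kaehler
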